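import Summits.QuantumFields.YangMills.Theorems.ColdStartUniversalityLatticeLangevinPlaquetteFirstVariation
import HarnessLib

/-!
# Route `ColdStartUniversality` (fixed-cut-off package, Bakry–Émery side): the CARRÉ DU CHAMP OF THE PLAQUETTE FUNCTION is `O(#𝒫)`,
# uniformly in the configuration — `Γ(ψ̂_b) = Σ_n (W_n ψ̂_b)² ≤ 64 b² #𝒫` for `ψ̂_b = b Σ_p Re tr U_p` on `SU(2)^E`, `E` = edges of `(ℤ/L)³`

Helper file (seat `ym-line-csu-p1`, g27; `--supports stmt-QuantumFields-24809`).  The input "`Γ(f) ≤ s`" of the volume-uniform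
concentration inequality `wilson_concentration_uniform` (`…BakryEmeryConcentration`, g26) for the one observable every reader asks
about first — the plaquette (action) density `P̄ = (#𝒫)⁻¹ Σ_p Re tr U_p` — with the explicit constant `s = 64/#𝒫`:
* §5 `frameDeriv_eq_mul_firstVariation` — the frame derivative of a function reading `β'·wilsonRe` through the coordinates is
  `β'·Σ_p plaqReDeriv(Q,A,p,0)` (first-order companion of `fderiv_frameDeriv_eq_mul_hessianForm`, g25);
* §6 ★★ `wilson_carreBound` — for every configuration `V`: `Σ_n (Dψ̂_b(y)[s_n y])² ≤ 64 b² #𝒫`, `y = coords V`, `s_n` the noise frame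
  (duality: with `a_n = W_nψ̂_b`, `Σ a_n² = Dψ̂_b[Σ a_n s_n] = b·δwilsonRe[A]`, `A_e = √2 Σ_ν a_(e,ν) 𝐩E_ν`, `Σ_e‖A_e‖² ≤ 2Σa_n²`, then
  `abs_firstVariation_le` (`…PlaquetteFirstVariation`) with `t = 1/(8|b|)`);
* §7 ★★ `wilson_plaquette_carre_le` — the same bound in the coordinate carré-du-champ currency `Σ_(ij) ∂_iψ̂_b ∂_jψ̂_b (σσᵀ)_(ij)(V) ≤ 64 b² #𝒫`
  (exactly the hypothesis shape of `wilson_concentration_uniform`).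
With `b = 1/#𝒫`: `Γ(P̄) ≤ 64/#𝒫` — the CLT scale.  (Shen–Zhu–Zhu, CMP 400 (2023), §3 Lemma 3.1 gives `∇𝒮`; the bound is folklore
bookkeeping.)  THEOREMS ONLY, no definition, no sorry.  HONEST FRAMING: fixed-cut-off plumbing for a RECORD rung; nothing K-uniform, no crux,
rung or summit statement is proved, and the Yang–Mills mass gap is NOT proved.
-/

set_option autoImplicit false

noncomputable section

namespace Summit.QuantumFields.YangMills.Theorems.ColdStartUniversality

open MeasureTheory Matrix Complex Finset
open scoped ComplexConjugate BigOperators Matrix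
open Literature.MathematicalPhysics.QuantumFieldTheory
open Literature.MathematicalPhysics.QuantumLattice (fundamentalRep fundamentalLatticeRep continuous_fundamentalRep fundamentalRep_apply)
open Summit.Ventures.YMGap.HessianSharp (perturb wilsonRe plaqRe plaqReDeriv hessianForm tangentNormSq frobSq
  hasDerivAt_wilsonRe_perturb)

variable {L : ℕ} [NeZero L]

/-! ## §5. The frame derivative of a function reading `β'·wilsonRe` is `β'·(first variation)` -/

section Curve

open scoped Matrix.Norms.Operator

/-- **First derivative along the exponential curve.**  For configurations `Q, A` (`A` skew-Hermitian), a `C¹` function `φ` of the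
real coordinates with `φ(flat M) = β'·wilsonRe M`, and a linear field `S` with `S z = flat(A · rebuild z)`:
`Dφ(flat Q)[S(flat Q)] = β' · Σ_p plaqReDeriv(Q,A,p,0)` (the curve `c(t) = flat(e^(tA)Q)` has `c' = S∘c`;
`hasDerivAt_wilsonRe_perturb`). [cite: ShenZhuZhu2022, §3 Lemma 3.1] -/
theorem frameDeriv_eq_mul_firstVariation (Q A : (Edge 3 L → Matrix (Fin (fundamentalLatticeRep 2).N) (Fin (fundamentalLatticeRep 2).N) ℂ)) (hA : ∀ e, (A e)ᴴ = -A e) (β' : ℝ)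
    (φ : (Edge 3 L × Fin (fundamentalLatticeRep 2).N × Fin (fundamentalLatticeRep 2).N × Bool → ℝ) → ℝ) (hφ : ContDiff ℝ 1 φ)
    (hφW : ∀ M : (Edge 3 L → Matrix (Fin (fundamentalLatticeRep 2).N) (Fin (fundamentalLatticeRep 2).N) ℂ), φ (fun q : Edge 3 L × Fin (fundamentalLatticeRep 2).N × Fin (fundamentalLatticeRep 2).N × Bool => (fun z : ℂ => if q.2.2.2 then z.im else z.re) (M q.1 q.2.1 q.2.2.1)) = β' * wilsonRe M)
    (S : (Edge 3 L × Fin (fundamentalLatticeRep 2).N × Fin (fundamentalLatticeRep 2).N × Bool → ℝ) →L[ℝ] (Edge 3 L × Fin (fundamentalLatticeRep 2).N × Fin (fundamentalLatticeRep 2).N × Bool → ℝ))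
    (hS : ∀ z : (Edge 3 L × Fin (fundamentalLatticeRep 2).N × Fin (fundamentalLatticeRep 2).N × Bool → ℝ), S z = (fun q : Edge 3 L × Fin (fundamentalLatticeRep 2).N × Fin (fundamentalLatticeRep 2).N × Bool => (fun z : ℂ => if q.2.2.2 then z.im else z.re) ((fun (e : Edge 3 L) => A e * (fun (ee : Edge 3 L) => Matrix.of fun (i j : Fin (fundamentalLatticeRep 2).N) => ((z (ee, i, j, false) : ℝ) : ℂ) + ((z (ee, i, j, true) : ℝ) : ℂ) * Complex.I) e) q.1 q.2.1 q.2.2.1))) :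
    fderiv ℝ φ (fun q : Edge 3 L × Fin (fundamentalLatticeRep 2).N × Fin (fundamentalLatticeRep 2).N × Bool => (fun z : ℂ => if q.2.2.2 then z.im else z.re) (Q q.1 q.2.1 q.2.2.1)) (S (fun q : Edge 3 L × Fin (fundamentalLatticeRep 2).N × Fin (fundamentalLatticeRep 2).N × Bool => (fun z : ℂ => if q.2.2.2 then z.im else z.re) (Q q.1 q.2.1 q.2.2.1))) = β' * ∑ p : Plaquette 3 L, plaqReDeriv Q A p.1 p.2.1.1 p.2.1.2 0 := by
  classical
  set reb : (Edge 3 L × Fin (fundamentalLatticeRep 2).N × Fin (fundamentalLatticeRep 2).N × Bool → ℝ) → (Edge 3 L → Matrix (Fin (fundamentalLatticeRep 2).N) (Fin (fundamentalLatticeRep 2).N) ℂ) := fun z => (fun (ee : Edge 3 L) => Matrix.of fun (i j : Fin (fundamentalLatticeRep 2).N) => ((z (ee, i, j, false) : ℝ) : ℂ) + ((z (ee, i, j, true) : ℝ) : ℂ) * Complex.I) with hreb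
  set flat : (Edge 3 L → Matrix (Fin (fundamentalLatticeRep 2).N) (Fin (fundamentalLatticeRep 2).N) ℂ) → (Edge 3 L × Fin (fundamentalLatticeRep 2).N × Fin (fundamentalLatticeRep 2).N × Bool → ℝ) := fun M => (fun q : Edge 3 L × Fin (fundamentalLatticeRep 2).N × Fin (fundamentalLatticeRep 2).N × Bool => (fun z : ℂ => if q.2.2.2 then z.im else z.re) (M q.1 q.2.1 q.2.2.1)) with hflat
  have r_flat : ∀ M : (Edge 3 L → Matrix (Fin (fundamentalLatticeRep 2).N) (Fin (fundamentalLatticeRep 2).N) ℂ), reb (flat M) = M := fun M => rebuild_flat_of M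
  have hS' : ∀ z : (Edge 3 L × Fin (fundamentalLatticeRep 2).N × Fin (fundamentalLatticeRep 2).N × Bool → ℝ), S z = flat (fun e => A e * reb z e) := fun z => hS z
  have hφW' : ∀ M : (Edge 3 L → Matrix (Fin (fundamentalLatticeRep 2).N) (Fin (fundamentalLatticeRep 2).N) ℂ), φ (flat M) = β' * wilsonRe M := fun M => hφW M
  -- `flat` as a continuous linear map
  have fl_add : ∀ M M' : (Edge 3 L → Matrix (Fin (fundamentalLatticeRep 2).N) (Fin (fundamentalLatticeRep 2).N) ℂ), flat (M + M') = flat M + flat M' := by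
    intro M M'; funext q; obtain ⟨e, i, j, b⟩ := q
    cases b
    · show ((M + M') e i j).re = (M e i j).re + (M' e i j).re
      rfl
    · show ((M + M') e i j).im = (M e i j).im + (M' e i j).im
      rfl
  have fl_smul : ∀ (a : ℝ) (M : (Edge 3 L → Matrix (Fin (fundamentalLatticeRep 2).N) (Fin (fundamentalLatticeRep 2).N) ℂ)), flat (a • M) = a • flat M := by
    intro a M; funext q; obtain ⟨e, i, j, b⟩ := q
    cases b
    · show (a • M e i j).re = a * (M e i j).re
      rw [Complex.smul_re, smul_eq_mul]
    · show (a • M e i j).im = a * (M e i j).im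
      rw [Complex.smul_im, smul_eq_mul]
  let Fl : (Edge 3 L → Matrix (Fin (fundamentalLatticeRep 2).N) (Fin (fundamentalLatticeRep 2).N) ℂ) →ₗ[ℝ] (Edge 3 L × Fin (fundamentalLatticeRep 2).N × Fin (fundamentalLatticeRep 2).N × Bool → ℝ) := { toFun := flat, map_add' := fl_add, map_smul' := fl_smul }
  let Fc : (Edge 3 L → Matrix (Fin (fundamentalLatticeRep 2).N) (Fin (fundamentalLatticeRep 2).N) ℂ) →L[ℝ] (Edge 3 L × Fin (fundamentalLatticeRep 2).N × Fin (fundamentalLatticeRep 2).N × Bool → ℝ) := LinearMap.toContinuousLinearMap Fl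
  have hFc : ∀ M, Fc M = flat M := fun M => rfl
  -- the curve `t ↦ e^(tA) Q` and its derivative
  set cM : ℝ → (Edge 3 L → Matrix (Fin (fundamentalLatticeRep 2).N) (Fin (fundamentalLatticeRep 2).N) ℂ) := fun t => perturb Q A t with hcM
  have hcM_d : ∀ t, HasDerivAt cM (fun e => A e * NormedSpace.exp (t • A e) * Q e) t := by
    intro t
    refine hasDerivAt_pi.2 fun e => ?_
    exact (hasDerivAt_exp_smul_const' (𝕂 := ℝ) (A e) t).mul_const (Q e)
  have hdir : ∀ t, Fc (fun e => A e * NormedSpace.exp (t • A e) * Q e) = S (flat (cM t)) := by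
    intro t
    rw [hFc, hS']
    have hin : (fun e => A e * NormedSpace.exp (t • A e) * Q e) = fun e => A e * reb (flat (cM t)) e :=
      funext fun e => by rw [r_flat, Matrix.mul_assoc]; rfl
    exact congrArg flat hin
  have hcd : ∀ t, HasDerivAt (fun t => flat (cM t)) (S (flat (cM t))) t := fun t =>
    (Fc.hasFDerivAt.comp_hasDerivAt t (hcM_d t)).congr_deriv (hdir t)
  have hc0 : flat (cM 0) = flat Q := by
    have h0 : cM 0 = Q := funext fun e => by
      simp only [hcM, perturb, zero_smul, NormedSpace.exp_zero, Matrix.one_mul]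
    rw [h0]
  -- first derivative of `φ ∘ c` two ways
  have hφd : Differentiable ℝ φ := hφ.differentiable one_ne_zero
  have hd1 : HasDerivAt (fun t => φ (flat (cM t))) (fderiv ℝ φ (flat (cM 0)) (S (flat (cM 0)))) 0 :=
    (hφd (flat (cM 0))).hasFDerivAt.comp_hasDerivAt 0 (hcd 0)
  have hW1 : HasDerivAt (fun t => φ (flat (cM t))) (β' * ∑ p : Plaquette 3 L, plaqReDeriv Q A p.1 p.2.1.1 p.2.1.2 0) 0 := by
    have hfun : (fun t => φ (flat (cM t))) = fun t => β' * wilsonRe (perturb Q A t) := funext fun t => hφW' (cM t)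
    rw [hfun]
    exact (hasDerivAt_wilsonRe_perturb Q A hA 0).const_mul β'
  have hkey := hd1.unique hW1
  rw [hc0] at hkey
  exact hkey

end Curve

/-! ## §6. The carré du champ of the plaquette function along the noise frame -/

/-- ★★ **`Γ(ψ̂_b) ≤ 64 b² #𝒫` pointwise.**  For every configuration `V` of `SU(2)^E` (`E` the edges of `(ℤ/L)³`) and every real `b`,
with `y = coords V`, `ψ̂_b(y) = b Σ_p Re tr U_p` and `σ_n(y) = coords δ_e(√2·𝐩(E_ν)·(rebuild y)_e)` the SZZ noise fields:
`Σ_n (Dψ̂_b(y)[σ_n(y)])² ≤ 64 · b² · #𝒫`, independently of `V` and of `L` beyond `#𝒫 = 3L³`.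
Proof: duality `Σ_n a_n² = Dψ̂_b(y)[Σ_n a_n σ_n(y)] = b·Σ_p plaqReDeriv(Q, A, p, 0)` with `A_e = √2 Σ_ν a_(e,ν) 𝐩E_ν`,
`Σ_e ‖A_e‖² ≤ 2 Σ_n a_n²`, and `abs_firstVariation_le` with `t = 1/(8|b|)`. [cite: ShenZhuZhu2022, §3 Lemma 3.1] -/
theorem wilson_carreBound (L : ℕ) [NeZero L] (β' : ℝ) (V : (GaugeConfig 3 L (Matrix.specialUnitaryGroup (Fin 2) ℂ))) :
    ∑ n : Edge 3 L × NoiseIdx (fundamentalLatticeRep 2).N, (fderiv ℝ (fun y : (Edge 3 L × Fin (fundamentalLatticeRep 2).N × Fin (fundamentalLatticeRep 2).N × Bool → ℝ) => β' * ∑ p : Plaquette 3 L, (rootedLoop (fun (ee : Edge 3 L) (i j : Fin (fundamentalLatticeRep 2).N) => ((y (ee, i, j, false) : ℝ) : ℂ) + ((y (ee, i, j, true) : ℝ) : ℂ) * Complex.I) (p.1, p.2.1.1) p.2.1.2 false).trace.re) ((fun (V : GaugeConfig 3 L (Matrix.specialUnitaryGroup (Fin 2) ℂ)) (q : Edge 3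 L × Fin (fundamentalLatticeRep 2).N × Fin (fundamentalLatticeRep 2).N × Bool) => (fun z : ℂ => if q.2.2.2 then z.im else z.re) ((fundamentalRep (Fin 2) (V q.1) : Matrix (Fin 2) (Fin 2) ℂ) q.2.1 q.2.2.1)) V) (fun q : Edge 3 L × Fin (fundamentalLatticeRep 2).N × Fin (fundamentalLatticeRep 2).N × Bool => if n.1 = q.1 then (fun z : ℂ => if q.2.2.2 then z.im else z.re) (((Real.sqrt 2 : ℂ) • ((fundamentalLatticeRep 2).lieProj (noiseDir n.2) * (fun (ee : Edge 3 L) => Matrix.of fun (i j : Fin (fundamentalLatticeRep 2).N) => (((fun (V : GaugeConfig 3 L (Matrix.specialUnitaryGroup (Fin 2) ℂ)) (q : Edge 3 L × Fin (fundamentalLatticeRep 2).N × Fin (fundamentalLatticeRep 2).N × Bool) => (fun z : ℂ => if q.2.2.2 then z.im else z.re) ((fundamentalRep (Fin 2) (V q.1) : Matrix (Fin 2) (Fin 2) ℂ) q.2.1 q.2.2.1)) V (ee, i, j, false) : ℝ) : ℂ) + (((fun (V : GaugeConfig 3 L (Matrix.specialUnitaryGroup (Fin 2) ℂ)) (q :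 Edge 3 L × Fin (fundamentalLatticeRep 2).N × Fin (fundamentalLatticeRep 2).N × Bool) => (fun z : ℂ => if q.2.2.2 then z.im else z.re) ((fundamentalRep (Fin 2) (V q.1) : Matrix (Fin 2) (Fin 2) ℂ) q.2.1 q.2.2.1)) V (ee, i, j, true) : ℝ) : ℂ) * Complex.I) q.1)) q.2.1 q.2.2.1) else 0)) ^ 2
      ≤ 64 * β' ^ 2 * Fintype.card (Plaquette 3 L) := by
  classical
  obtain ⟨s, c, hs, -, -, -, -⟩ := exists_noiseFrame L
  -- abbreviations
  set P : NoiseIdx (fundamentalLatticeRep 2).N → Matrix (Fin (fundamentalLatticeRep 2).N) (Fin (fundamentalLatticeRep 2).N) ℂ := fun ν => (fundamentalLatticeRep 2).lieProj (noiseDir ν) with hP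
  set reb : (Edge 3 L × Fin (fundamentalLatticeRep 2).N × Fin (fundamentalLatticeRep 2).N × Bool → ℝ) → (Edge 3 L → Matrix (Fin (fundamentalLatticeRep 2).N) (Fin (fundamentalLatticeRep 2).N) ℂ) := fun z => (fun (ee : Edge 3 L) => Matrix.of fun (i j : Fin (fundamentalLatticeRep 2).N) => ((z (ee, i, j, false) : ℝ) : ℂ) + ((z (ee, i, j, true) : ℝ) : ℂ) * Complex.I) with hreb
  set flat : (Edge 3 L → Matrix (Fin (fundamentalLatticeRep 2).N) (Fin (fundamentalLatticeRep 2).N) ℂ) → (Edge 3 L × Fin (fundamentalLatticeRep 2).N × Fin (fundamentalLatticeRep 2).N × Bool → ℝ) := fun M => (fun q : Edge 3 L × Fin (fundamentalLatticeRep 2).N × Fin (fundamentalLatticeRep 2).N × Bool => (fun z : ℂ => if q.2.2.2 then z.im else z.re) (M q.1 q.2.1 q.2.2.1)) with hflat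
  set σ : (Edge 3 L × NoiseIdx (fundamentalLatticeRep 2).N) → (Edge 3 L × Fin (fundamentalLatticeRep 2).N × Fin (fundamentalLatticeRep 2).N × Bool → ℝ) → (Edge 3 L × Fin (fundamentalLatticeRep 2).N × Fin (fundamentalLatticeRep 2).N × Bool → ℝ) := fun n z => (fun q : Edge 3 L × Fin (fundamentalLatticeRep 2).N × Fin (fundamentalLatticeRep 2).N × Bool => if n.1 = q.1 then (fun z : ℂ => if q.2.2.2 then z.im else z.re) (((Real.sqrt 2 : ℂ) • ((fundamentalLatticeRep 2).lieProj (noiseDir n.2) * (fun (ee : Edge 3 L) => Matrix.of fun (i j : Fin (fundamentalLatticeRep 2).N) => ((z (ee, i, j, false) : ℝ) : ℂ) + ((z (ee, i, j, true) : ℝ) : ℂ) * Complex.I) q.1)) q.2.1 q.2.2.1) else 0) with hσ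
  set ψ : (Edge 3 L × Fin (fundamentalLatticeRep 2).N × Fin (fundamentalLatticeRep 2).N × Bool → ℝ) → ℝ := (fun y : (Edge 3 L × Fin (fundamentalLatticeRep 2).N × Fin (fundamentalLatticeRep 2).N × Bool → ℝ) => β' * ∑ p : Plaquette 3 L, (rootedLoop (fun (ee : Edge 3 L) (i j : Fin (fundamentalLatticeRep 2).N) => ((y (ee, i, j, false) : ℝ) : ℂ) + ((y (ee, i, j, true) : ℝ) : ℂ) * Complex.I) (p.1, p.2.1.1) p.2.1.2 false).trace.re) with hψ
  set y : (Edge 3 L × Fin (fundamentalLatticeRep 2).N × Fin (fundamentalLatticeRep 2).N × Bool → ℝ) := (fun (V : GaugeConfig 3 L (Matrix.specialUnitaryGroup (Fin 2) ℂ)) (q : Edge 3 L × Fin (fundamentalLatticeRep 2).N × Fin (fundamentalLatticeRep 2).N × Bool) => (fun z : ℂ => if q.2.2.2 then z.im else z.re) ((fundamentalRep (Fin 2) (V q.1) : Matrix (Fin 2) (Fin 2) ℂ) q.2.1 q.2.2.1)) V with hy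
  have hsσ : ∀ n z, s n z = σ n z := fun n z => hs n z
  -- `rebuild` facts
  have r_smul : ∀ (a : ℝ) (v : (Edge 3 L × Fin (fundamentalLatticeRep 2).N × Fin (fundamentalLatticeRep 2).N × Bool → ℝ)), reb (a • v) = (a : ℂ) • reb v := fun a v => rebuild_smul a v
  have r_sum : ∀ f : (Edge 3 L × NoiseIdx (fundamentalLatticeRep 2).N) → (Edge 3 L × Fin (fundamentalLatticeRep 2).N × Fin (fundamentalLatticeRep 2).N × Bool → ℝ), reb (∑ k, f k) = ∑ k, reb (f k) :=
    fun f => rebuild_sum Finset.univ f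
  have r_inj : ∀ v w : (Edge 3 L × Fin (fundamentalLatticeRep 2).N × Fin (fundamentalLatticeRep 2).N × Bool → ℝ), reb v = reb w → v = w := fun v w h => eq_of_rebuild_eq h
  have r_flat : ∀ M : (Edge 3 L → Matrix (Fin (fundamentalLatticeRep 2).N) (Fin (fundamentalLatticeRep 2).N) ℂ), reb (flat M) = M := fun M => rebuild_flat_of M
  have r_σ : ∀ n z, reb (σ n z) = fun e => if n.1 = e then (Real.sqrt 2 : ℂ) • (P n.2 * reb z e) else 0 :=
    fun n z => rebuild_noise n z
  have flat_reb : ∀ v : (Edge 3 L × Fin (fundamentalLatticeRep 2).N × Fin (fundamentalLatticeRep 2).N × Bool → ℝ), flat (reb v) = v := fun v => r_inj _ _ (r_flat _)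
  -- the coefficients `x_n = Dψ̂(y)[s_n y]` and the combined field `S = Σ_n x_n s_n`
  set x : Edge 3 L × NoiseIdx (fundamentalLatticeRep 2).N → ℝ := fun n => fderiv ℝ ψ y (s n y) with hx
  set S : (Edge 3 L × Fin (fundamentalLatticeRep 2).N × Fin (fundamentalLatticeRep 2).N × Bool → ℝ) →L[ℝ] (Edge 3 L × Fin (fundamentalLatticeRep 2).N × Fin (fundamentalLatticeRep 2).N × Bool → ℝ) := ∑ n, x n • s n with hSdef
  have hS_apply : ∀ z, S z = ∑ n, x n • s n z := fun z => by
    rw [hSdef, _root_.sum_apply]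
    simp only [FunLike.coe_smul, Pi.smul_apply]
  -- the matrices `Z_e = Σ_ν x_(e,ν) 𝐩E_ν ∈ 𝔤`, `A_e = √2 Z_e`, `Q_e = V_e`
  set Z : (Edge 3 L → Matrix (Fin (fundamentalLatticeRep 2).N) (Fin (fundamentalLatticeRep 2).N) ℂ) := fun e => ∑ ν, x (e, ν) • P ν with hZ
  set A : (Edge 3 L → Matrix (Fin (fundamentalLatticeRep 2).N) (Fin (fundamentalLatticeRep 2).N) ℂ) := fun e => (Real.sqrt 2 : ℂ) • Z e with hA
  set Q : (Edge 3 L → Matrix (Fin (fundamentalLatticeRep 2).N) (Fin (fundamentalLatticeRep 2).N) ℂ) := fun e => Matrix.of fun i j : Fin (fundamentalLatticeRep 2).N =>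
    (fundamentalRep (Fin 2) (V e) : Matrix (Fin 2) (Fin 2) ℂ) i j with hQ
  have hrebY : reb y = Q := rebuild_coords_of V
  have hyQ : flat Q = y := by rw [← hrebY, flat_reb]
  have hZmem : ∀ e, Z e ∈ (fundamentalLatticeRep 2).lieAlg := fun e =>
    Submodule.sum_mem _ fun ν _ => Submodule.smul_mem _ _ ((fundamentalLatticeRep 2).lieProj_mem _)
  have hZskew : ∀ e, (Z e)ᴴ = -Z e := fun e => by
    rw [← Matrix.star_eq_conjTranspose]
    exact (fundamentalLatticeRep 2).star_eq_neg_of_mem_lieAlg (hZmem e)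
  have hAskew : ∀ e, (A e)ᴴ = -A e := fun e => by
    simp only [hA, Matrix.conjTranspose_smul, RCLike.star_def, Complex.conj_ofReal, hZskew, smul_neg]
  have hQU : ∀ e, Q e ∈ Matrix.unitaryGroup (Fin (fundamentalLatticeRep 2).N) ℂ := fun e =>
    Matrix.specialUnitaryGroup_le_unitaryGroup (V e).2
  -- real vs complex scalars on matrices
  have cx : ∀ (a : ℝ) (W : Matrix (Fin (fundamentalLatticeRep 2).N) (Fin (fundamentalLatticeRep 2).N) ℂ), a • W = (a : ℂ) • W := fun a W => by
    ext i j
    simp only [Matrix.smul_apply, Complex.real_smul, smul_eq_mul]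
  -- (F1) `rebuild (S z) = (A_e · rebuild(z)_e)_e`
  have hrebS : ∀ z, reb (S z) = fun e => A e * reb z e := by
    intro z
    rw [hS_apply, r_sum]
    simp_rw [r_smul, hsσ, r_σ]
    funext e
    rw [Finset.sum_apply]
    have hsplit : ∑ n : Edge 3 L × NoiseIdx (fundamentalLatticeRep 2).N,
        ((x n : ℂ) • (fun e' : Edge 3 L => if n.1 = e' then (Real.sqrt 2 : ℂ) • (P n.2 * reb z e') else (0 : Matrix (Fin (fundamentalLatticeRep 2).N) (Fin (fundamentalLatticeRep 2).N) ℂ))) e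
        = ∑ e' : Edge 3 L, ∑ ν : NoiseIdx (fundamentalLatticeRep 2).N,
          ((x (e', ν) : ℂ) • (fun e'' : Edge 3 L => if (e', ν).1 = e'' then (Real.sqrt 2 : ℂ) • (P (e', ν).2 * reb z e'') else (0 : Matrix (Fin (fundamentalLatticeRep 2).N) (Fin (fundamentalLatticeRep 2).N) ℂ))) e :=
      Fintype.sum_prod_type _
    rw [hsplit, Finset.sum_eq_single e (fun e' _ hne => Finset.sum_eq_zero fun ν _ => by
      simp only [Pi.smul_apply, if_neg hne, smul_zero]) (fun h => absurd (Finset.mem_univ e) h)]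
    simp only [Pi.smul_apply, if_true, hA, hZ, Finset.smul_sum, Finset.sum_mul, Matrix.smul_mul]
    refine Finset.sum_congr rfl fun ν _ => ?_
    rw [cx, smul_comm]
  have hSflat : ∀ z, S z = flat (fun e => A e * reb z e) := fun z =>
    r_inj _ _ ((hrebS z).trans (r_flat _).symm)
  -- `ψ̂(flat M) = β' · wilsonRe M`
  have hψW : ∀ M : (Edge 3 L → Matrix (Fin (fundamentalLatticeRep 2).N) (Fin (fundamentalLatticeRep 2).N) ℂ), ψ (flat M) = β' * wilsonRe M := by
    intro M
    have h1 : ψ (flat M) = β' * ∑ p : Plaquette 3 L, (rootedLoop (reb (flat M)) (p.1, p.2.1.1) p.2.1.2 false).trace.re := rfl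
    rw [h1, r_flat]
    simp only [wilsonRe, plaqRe, rootedLoop]
  have hψC : ContDiff ℝ 1 ψ := contDiff_psiHat (d := 3) (L := L) (N := (fundamentalLatticeRep 2).N) (n := 1) β'
  -- (F2) the first-order identity `Dψ̂(y)[S y] = β' · Σ_p plaqReDeriv Q A p 0`
  have hkey : fderiv ℝ ψ y (S y) = β' * ∑ p : Plaquette 3 L, plaqReDeriv Q A p.1 p.2.1.1 p.2.1.2 0 := by
    have h : fderiv ℝ ψ (flat Q) (S (flat Q)) = β' * ∑ p : Plaquette 3 L, plaqReDeriv Q A p.1 p.2.1.1 p.2.1.2 0 :=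
      frameDeriv_eq_mul_firstVariation Q A hAskew β' ψ hψC hψW S hSflat
    rw [hyQ] at h
    exact h
  -- (F3) duality: `Dψ̂(y)[S y] = Σ_n x_n²`
  have hexp : fderiv ℝ ψ y (S y) = ∑ n, x n ^ 2 := by
    rw [hS_apply, map_sum]
    refine Finset.sum_congr rfl fun n _ => ?_
    rw [map_smul, smul_eq_mul, sq]
  -- (F4) `Σ_e ‖A_e‖² ≤ 2 Σ_n x_n²`
  have hT : tangentNormSq A ≤ 2 * ∑ n, x n ^ 2 := by
    have hTe : tangentNormSq A = ∑ e, hsForm (fundamentalLatticeRep 2).N (A e) (A e) := rfl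
    have hAe : ∀ e, hsForm (fundamentalLatticeRep 2).N (A e) (A e) = 2 * hsForm (fundamentalLatticeRep 2).N (Z e) (Z e) := fun e => by
      show hsForm (fundamentalLatticeRep 2).N ((Real.sqrt 2 : ℂ) • Z e) ((Real.sqrt 2 : ℂ) • Z e) = _
      rw [hsForm_coe_smul_left, hsForm_coe_smul_right, ← mul_assoc, Real.mul_self_sqrt zero_le_two]
    have hZe : ∀ e, hsForm (fundamentalLatticeRep 2).N (Z e) (Z e) ≤ ∑ ν, x (e, ν) ^ 2 := fun e => by
      have hZp : Z e = (fundamentalLatticeRep 2).lieProj (∑ ν, x (e, ν) • noiseDir ν) := by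
        show ∑ ν, x (e, ν) • P ν = _
        rw [map_sum]
        simp only [map_smul, hP]
      rw [hZp, ← hsForm_sum_smul_noiseDir_self]
      exact hsForm_lieProj_self_le (fundamentalLatticeRep 2) _
    have hsum : ∑ e, hsForm (fundamentalLatticeRep 2).N (Z e) (Z e) ≤ ∑ e : Edge 3 L, ∑ ν : NoiseIdx (fundamentalLatticeRep 2).N, x (e, ν) ^ 2 :=
      Finset.sum_le_sum fun e _ => hZe e
    have hprod : ∑ n, x n ^ 2 = ∑ e : Edge 3 L, ∑ ν : NoiseIdx (fundamentalLatticeRep 2).N, x (e, ν) ^ 2 :=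
      Fintype.sum_prod_type (fun n : Edge 3 L × NoiseIdx (fundamentalLatticeRep 2).N => x n ^ 2)
    rw [hTe, hprod, Finset.sum_congr rfl fun e _ => hAe e, ← Finset.mul_sum]
    linarith
  -- (F5) assembly
  have hxn : 0 ≤ ∑ n, x n ^ 2 := Finset.sum_nonneg fun n _ => sq_nonneg _
  have hN : (Fintype.card (Fin (fundamentalLatticeRep 2).N) : ℝ) = 2 := by
    rw [Fintype.card_fin]
    rfl
  have main : ∑ n, x n ^ 2 ≤ 64 * β' ^ 2 * Fintype.card (Plaquette 3 L) := by
    by_cases hb : β' = 0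
    · have h0 : ∑ n, x n ^ 2 = 0 := by rw [← hexp, hkey, hb, zero_mul]
      rw [h0, hb]
      simp
    · have hbpos : 0 < |β'| := abs_pos.2 hb
      set t : ℝ := 1 / (8 * |β'|) with ht
      have htpos : 0 < t := by positivity
      have hFV := abs_firstVariation_le Q A hQU htpos
      rw [hN] at hFV
      have hd : ((3 : ℕ) : ℝ) - 1 = 2 := by norm_num
      rw [hd] at hFV
      have h1 : ∑ n, x n ^ 2 ≤ |β'| * |∑ p : Plaquette 3 L, plaqReDeriv Q A p.1 p.2.1.1 p.2.1.2 0| := by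
        rw [← hexp, hkey, ← abs_mul]
        exact le_abs_self _
      have h2 : |∑ p : Plaquette 3 L, plaqReDeriv Q A p.1 p.2.1.1 p.2.1.2 0| ≤
          t * 2 * (2 * ∑ n, x n ^ 2) + 2 * 2 * Fintype.card (Plaquette 3 L) / t := by
        refine hFV.trans (add_le_add ?_ le_rfl)
        exact mul_le_mul_of_nonneg_left hT (by positivity)
      have h3 : ∑ n, x n ^ 2 ≤ |β'| * (t * 2 * (2 * ∑ n, x n ^ 2) + 2 * 2 * Fintype.card (Plaquette 3 L) / t) :=
        h1.trans (mul_le_mul_of_nonneg_left h2 hbpos.le)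
      have e1 : |β'| * (t * 2 * (2 * ∑ n, x n ^ 2) + 2 * 2 * Fintype.card (Plaquette 3 L) / t) =
          (1 / 2) * ∑ n, x n ^ 2 + 32 * |β'| ^ 2 * Fintype.card (Plaquette 3 L) := by
        rw [ht]
        field_simp
        ring
      rw [e1, sq_abs] at h3
      linarith
  -- back to the statement's vocabulary
  have hsV : ∀ k : Edge 3 L × NoiseIdx (fundamentalLatticeRep 2).N, s k y = σ k y := fun k => hs k y
  simp only [hx, hsV] at main
  exact main

/-! ## §7. The coordinate carré-du-champ form (the hypothesis shape of `wilson_concentration_uniform`) -/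

/-- ★★ **The carré du champ of the plaquette function is at most `64 b² #𝒫`, uniformly.**  For every coupling `β'` (entering only
through the — `β'`-independent — noise coefficient), every real `b`, and every configuration `V`, with `Γ(f)(V) = Σ_(ij) ∂_if ∂_jf (σσᵀ)_(ij)(V)`
the carré du champ of the SZZ coordinate generator and `ψ̂_b = b Σ_p Re tr U_p` as a function of the real link coordinates:
`Γ(ψ̂_b)(V) ≤ 64 · b² · #𝒫`.  With `b = 1/#𝒫` this is `Γ(P̄) ≤ 64/#𝒫` for the plaquette average `P̄`.
[cite: ShenZhuZhu2022, §3 Lemma 3.1] -/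
theorem wilson_plaquette_carre_le (L : ℕ) [NeZero L] (β' b : ℝ) :
    let coords : GaugeConfig 3 L (Matrix.specialUnitaryGroup (Fin 2) ℂ) → (Edge 3 L × Fin 2 × Fin 2 × Bool → ℝ) :=
      fun V q => (fun z : ℂ => if q.2.2.2 then z.im else z.re)
        ((fundamentalRep (Fin 2) (V q.1) : Matrix (Fin 2) (Fin 2) ℂ) q.2.1 q.2.2.1)
    let A : GaugeConfig 3 L (Matrix.specialUnitaryGroup (Fin 2) ℂ) → (Edge 3 L × Fin 2 × Fin 2 × Bool) →
        (Edge 3 L × Fin 2 × Fin 2 × Bool) → ℝ := fun V i j =>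
      ∑ n : Edge 3 L × NoiseIdx 2,
        (if n.1 = i.1 then (fun z : ℂ => if i.2.2.2 then z.im else z.re)
          ((latticeLangevinDynamics (fundamentalLatticeRep 2) β').noise
            (matrixConfig (fundamentalRep (Fin 2)) V) i.1 n.2 i.2.1 i.2.2.1) else 0) *
        (if n.1 = j.1 then (fun z : ℂ => if j.2.2.2 then z.im else z.re)
          ((latticeLangevinDynamics (fundamentalLatticeRep 2) β').noise
            (matrixConfig (fundamentalRep (Fin 2)) V) j.1 n.2 j.2.1 j.2.2.1) else 0)
    ∀ V : (GaugeConfig 3 L (Matrix.specialUnitaryGroup (Fin 2) ℂ)), (∑ i : Edge 3 L × Fin 2 × Fin 2 × Bool, ∑ j : Edge 3 L × Fin 2 × Fin 2 × Bool,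
      fderiv ℝ (fun y : (Edge 3 L × Fin 2 × Fin 2 × Bool → ℝ) => b * ∑ p : Plaquette 3 L, (rootedLoop (fun (ee : Edge 3 L) (i j : Fin 2) => ((y (ee, i, j, false) : ℝ) : ℂ) + ((y (ee, i, j, true) : ℝ) : ℂ) * Complex.I) (p.1, p.2.1.1) p.2.1.2 false).trace.re) (coords V) (Pi.single i 1) * fderiv ℝ (fun y : (Edge 3 L × Fin 2 × Fin 2 × Bool → ℝ) => b * ∑ p : Plaquette 3 L, (rootedLoop (fun (ee : Edge 3 L) (i j : Fin 2) => ((y (ee, i, j, false) : ℝ) : ℂ) + ((y (ee, i, j, true) : ℝ) : ℂ) * Complex.I) (p.1, p.2.1.1) p.2.1.2 false).trace.re) (coords V) (Pi.single j 1) * A V i j)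
        ≤ 64 * b ^ 2 * Fintype.card (Plaquette 3 L) := by
  intro coords A V
  classical
  set c : Edge 3 L × Fin 2 × Fin 2 × Bool → ℝ := coords V with hc
  set Q : MatrixConfig 3 L (fundamentalLatticeRep 2).N := matrixConfig (fundamentalRep (Fin 2)) V with hQdef
  -- the real coordinate functionals and the coordinate vectors of the noise
  set coordOf : (Fin 2 × Fin 2 × Bool) → Matrix (Fin (fundamentalLatticeRep 2).N) (Fin (fundamentalLatticeRep 2).N) ℂ → ℝ := fun p X =>
    (fun z : ℂ => if p.2.2 then z.im else z.re) (X p.1 p.2.1) with hcoordOf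
  set σ : (Edge 3 L × Fin 2 × Fin 2 × Bool) → (Edge 3 L × NoiseIdx 2) → ℝ := fun i n =>
    if n.1 = i.1 then coordOf i.2 ((latticeLangevinDynamics (fundamentalLatticeRep 2) β').noise Q i.1 n.2) else 0 with hσ
  have hA : ∀ i j, A V i j = ∑ n, σ i n * σ j n := fun i j => rfl
  set D : (Edge 3 L × Fin 2 × Fin 2 × Bool → ℝ) →L[ℝ] ℝ := fderiv ℝ (fun y : (Edge 3 L × Fin 2 × Fin 2 × Bool → ℝ) => b * ∑ p : Plaquette 3 L, (rootedLoop (fun (ee : Edge 3 L) (i j : Fin 2) => ((y (ee, i, j, false) : ℝ) : ℂ) + ((y (ee, i, j, true) : ℝ) : ℂ) * Complex.I) (p.1, p.2.1.1) p.2.1.2 false).trace.re) c with hD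
  have h1 : ∑ i, ∑ j, D (Pi.single i 1) * D (Pi.single j 1) * A V i j = ∑ n, (D (fun i => σ i n)) ^ 2 := by
    simp_rw [hA]
    rw [sum_sum_mul_mul_noiseCov_eq_sum_sq (fun i => D (Pi.single i 1)) σ]
    exact Finset.sum_congr rfl fun n _ => by rw [sum_apply_single_mul_eq_apply]
  rw [h1]
  -- the coordinate vector of the noise `n` is the frame field `σ_n(c)`
  have hrebQ : ∀ e : Edge 3 L, (Matrix.of fun a b : Fin (fundamentalLatticeRep 2).N => ((c (e, a, b, false) : ℝ) : ℂ) + ((c (e, a, b, true) : ℝ) : ℂ) * Complex.I) = Q e :=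
    fun e => (congrFun (rebuild_coords_of V) e).trans (Matrix.ext fun a b => rfl)
  have hvec : ∀ n : Edge 3 L × NoiseIdx 2, (fun i => σ i n) = (fun q : Edge 3 L × Fin (fundamentalLatticeRep 2).N × Fin (fundamentalLatticeRep 2).N × Bool => if n.1 = q.1 then (fun z : ℂ => if q.2.2.2 then z.im else z.re) (((Real.sqrt 2 : ℂ) • ((fundamentalLatticeRep 2).lieProj (noiseDir n.2) * (fun (ee : Edge 3 L) => Matrix.of fun (i j : Fin (fundamentalLatticeRep 2).N) => ((c (ee, i, j, false) : ℝ) : ℂ) + ((c (ee, i, j, true) : ℝ) : ℂ) * Complex.I) q.1)) q.2.1 q.2.2.1) else 0) := by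
    intro n
    funext i
    simp only [hσ, hcoordOf]
    by_cases h : n.1 = i.1
    · rw [if_pos h, if_pos h, latticeLangevinDynamics_noise, hrebQ]
    · rw [if_neg h, if_neg h]
  simp_rw [hvec]
  have h6 : ∑ n : Edge 3 L × NoiseIdx 2, (D (fun q : Edge 3 L × Fin (fundamentalLatticeRep 2).N × Fin (fundamentalLatticeRep 2).N × Bool => if n.1 = q.1 then (fun z : ℂ => if q.2.2.2 then z.im else z.re) (((Real.sqrt 2 : ℂ) • ((fundamentalLatticeRep 2).lieProj (noiseDir n.2) * (fun (ee : Edge 3 L) => Matrix.of fun (i j : Fin (fundamentalLatticeRep 2).N) => ((c (ee, i, j, false) : ℝ) : ℂ) + ((c (ee, i, j, true) : ℝ) : ℂ) * Complex.I) q.1)) q.2.1 q.2.2.1) else 0)) ^ 2 ≤ 64 * b ^ 2 * Fintype.card (Plaquette 3 L) :=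
    wilson_carreBound L b V
  exact h6

end Summit.QuantumFields.YangMills.Theorems.ColdStartUniversality
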